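import Summits.AtomisticToContinuum.FouriersLaw.Theorems.BondHeatUncertaintySubdiffusiveBondHeatJunctionSplitLaw

/-!
# `JunctionDefectGrading` — file 4: the buffered series law READ OFF THE STEADY-STATE TEMPERATURE PROFILE
# (cell `decomp-a2c`, lens-1 «grading / quantitative ladder», gen 56; beneath `BufferedSeriesLaw ⟹ 11071` of file 3)

The imposed difference `δ = T_L − T_R` across the chain `[ block u | buffer L₀ | block v ]` (`N = u + L₀ + v`, steady state `μ_δ` at
`(T + δ/2, T − δ/2)`) telescopes EXACTLY through the two interface kinetic temperatures `τ_a = ⟨p_{u−1}²⟩_δ` (last site of the left block)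
and `τ_b = ⟨p_{u+L₀}²⟩_δ` (first site of the right block): `δ = [(T + δ/2) − τ_a] + [τ_a − τ_b] + [τ_b − (T − δ/2)]`.  Normalising by the
tree's response identity `j/δ → γ·E_N` (per-bond current `j`, `D_N = (N−1)γE_N`, `…IffBoundedResponse`) and the contact law `j = γ(T_L − ⟨p_0²⟩)`
(`VanishingNoiseBound.totalCurrent_eq_left`), the three first-order drops are three IN-SITU RESISTANCES in units of the contact resistance `1/γ`,
and `BufferedSeriesLaw` (`r_u + r_v ≤ r_N`, `r = 1/E`) splits into two profile statements with ONE shared constant `c` (the contact budget):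
* `EmbeddedBlockLawAt … c L₀` — LOCALITY: the in-situ drop over each embedded block is, to first order in `δ`, at least `E_N·(r_block − c)·δ`:
  embedding a block into a longer chain lowers its resistance by at most `c` (the far contact it no longer pays) [piece · locality];
* `BufferFloorAt … c L₀` — LOCAL OHMIC FLOOR: the buffer carries a first-order drop at least `2c·E_N·δ`: an interior segment of fixed length `L₀`
  has in-situ resistance `≥ 2c` (kinetically `≈ L₀·γ/κ`, so `L₀ ≳ 2cκ/γ` — the census sign change `L₀(T) ≈ C₀κ`, memo IDEA-g56 §1) [piece · local floor].
Seam (PROVED, pure bookkeeping: add the three inequalities at one small `δ` and one steady state, which EXISTS by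
`pinnedChain_exists_isSteadyState`; divide by `δ` and by `E_N > 0`): `series_of_profileAt`, `bufferedSeriesLaw_of_profileSplitLaw :
ProfileSplitLaw → BufferedSeriesLaw`, hence `boundedResponse_of_profileSplitLaw : ProfileSplitLaw → BoundedResponse` (11071 BY NAME).
The harmonic member fails exactly `BufferFloorAt` (flat bulk profile, exponentially localised boundary jumps — Rieder–Lebowitz–Lieb), not the
locality piece.  Both pieces are first-order NESS PROFILE statements: INSTRUMENTABLE by the standing census engine (profile fractions
`φ(i) = (T_L − ⟨p_i²⟩)/δ`; prediction at T = 10, cell (64,96,64): φ(63) ≥ 0.34, φ(160) − φ(63) ≥ 0.25, 1 − φ(160) ≥ 0.34 with c ≈ 1.75).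
No `sorry`; standard axioms; imports only file 3 (tree).
-/

noncomputable section

open MeasureTheory Set
open Literature.MathematicalPhysics.KineticTheory.HeatConduction

namespace Summit.AtomisticToContinuum.FouriersLaw.Theorems.SubdiffusiveBondHeat

namespace JunctionDefectGrading

open Summit.AtomisticToContinuum.FouriersLaw.Theses.BondHeatUncertainty (BoundedResponse)
open Summit.AtomisticToContinuum.FouriersLaw.Theorems.SubdiffusiveBondHeat.EscapeGrading (escapeDeficit)

/-! ## A. The two profile pieces (at fixed parameters and temperature; `c` = contact budget, `L₀` = buffer length) -/

/-- **Embedded-block law (locality)** at `(ω₂, lam, β, γ, T)` with contact budget `c` and buffer `L₀`: `∃ N₂, ∀ u v ≥ N₂` (`u, v ≥ 1`),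
`∀ ε > 0`, for all small `δ > 0` and every steady state `μ` of the `(u + L₀ + v)`-chain at `(T + δ/2, T − δ/2)`:
`(T + δ/2) − ⟨p_{u−1}²⟩_μ ≥ δ·(E_N·(1/E_u − c) − ε)` and `⟨p_{u+L₀}²⟩_μ − (T − δ/2) ≥ δ·(E_N·(1/E_v − c) − ε)`, `E = escapeDeficit … T`.
Ratio form: in-situ block resistance `γ·drop/j ≥ r_block − c + o(1)`.  Tags: UNDECIDED · IDEA-NEEDED (no locality estimate for the NESS
profile of the anharmonic pinned chain in tree or print) · INSTRUMENTABLE (first-order profile fractions). [piece · locality] -/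
def EmbeddedBlockLawAt (ω₂ lam β γ T c : ℝ) (L₀ : ℕ) : Prop :=
  ∃ N₂ : ℕ, ∀ u v : ℕ, N₂ ≤ u → N₂ ≤ v → ∀ (_hu : 1 ≤ u) (_hv : 1 ≤ v), ∀ ε : ℝ, 0 < ε →
    ∃ δ₀ : ℝ, 0 < δ₀ ∧ ∀ δ : ℝ, 0 < δ → δ < δ₀ →
      ∀ μ : Measure (PhaseSpace (u + L₀ + v)),
        (pinnedChain ω₂ lam β γ).IsSteadyState (u + L₀ + v) (T + δ / 2) (T - δ / 2) μ →
          δ * (escapeDeficit ω₂ lam β γ T (u + L₀ + v) * (1 / escapeDeficit ω₂ lam β γ T u - c) - ε)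
              ≤ (T + δ / 2) - ∫ x, x.2 ⟨u - 1, by omega⟩ ^ 2 ∂μ ∧
          δ * (escapeDeficit ω₂ lam β γ T (u + L₀ + v) * (1 / escapeDeficit ω₂ lam β γ T v - c) - ε)
              ≤ ∫ x, x.2 ⟨u + L₀, by omega⟩ ^ 2 ∂μ - (T - δ / 2)

/-- **Buffer floor (local Ohmic floor)** at `(ω₂, lam, β, γ, T)` with the SAME `c`, `L₀`: `∃ N₂, ∀ u v ≥ N₂` (`u, v ≥ 1`), `∀ ε > 0`, for all
small `δ > 0` and every steady state `μ` of the `(u + L₀ + v)`-chain at `(T + δ/2, T − δ/2)`: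
`⟨p_{u−1}²⟩_μ − ⟨p_{u+L₀}²⟩_μ ≥ δ·(2c·E_N − ε)` — the buffer's in-situ resistance is at least `2c`.  Tags: UNDECIDED · IDEA-NEEDED (a LOCAL
first-order Fourier inequality: current ⇒ gradient across a fixed interior segment) · INSTRUMENTABLE; FALSE at the harmonic member (flat bulk
profile), which is where the buffered line must use `0 < lam, 0 < β`. [piece · local floor] -/
def BufferFloorAt (ω₂ lam β γ T c : ℝ) (L₀ : ℕ) : Prop :=
  ∃ N₂ : ℕ, ∀ u v : ℕ, N₂ ≤ u → N₂ ≤ v → ∀ (_hu : 1 ≤ u) (_hv : 1 ≤ v), ∀ ε : ℝ, 0 < ε →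
    ∃ δ₀ : ℝ, 0 < δ₀ ∧ ∀ δ : ℝ, 0 < δ → δ < δ₀ →
      ∀ μ : Measure (PhaseSpace (u + L₀ + v)),
        (pinnedChain ω₂ lam β γ).IsSteadyState (u + L₀ + v) (T + δ / 2) (T - δ / 2) μ →
          δ * (2 * c * escapeDeficit ω₂ lam β γ T (u + L₀ + v) - ε)
              ≤ ∫ x, x.2 ⟨u - 1, by omega⟩ ^ 2 ∂μ - ∫ x, x.2 ⟨u + L₀, by omega⟩ ^ 2 ∂μ

/-- **Profile split law**: for all parameters and `T > 0` there are a contact budget `c` and a buffer length `L₀` for which both profile pieces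
hold.  Implies `BufferedSeriesLaw` (`bufferedSeriesLaw_of_profileSplitLaw`), hence 11071. [piece · conjunction] -/
def ProfileSplitLaw : Prop :=
  ∀ ω₂ lam β γ : ℝ, 0 < ω₂ → 0 < lam → 0 < β → 0 < γ → ∀ T : ℝ, 0 < T →
    ∃ c : ℝ, ∃ L₀ : ℕ, EmbeddedBlockLawAt ω₂ lam β γ T c L₀ ∧ BufferFloorAt ω₂ lam β γ T c L₀

/-! ## B. The seam: three first-order drops telescope to `δ` -/

/-- **Locality + buffer floor ⟹ the buffered series inequality at this temperature**: `∃ N₂, ∀ u v ≥ N₂, 1/E_u + 1/E_v ≤ 1/E_{u+L₀+v}`.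
Proof: at one small `δ > 0` and one steady state (which exists), the three inequalities add up to `δ·(E_N(1/E_u + 1/E_v) − 3ε) ≤ δ`;
let `ε → 0` and divide by `E_N > 0` (`escapeDeficit_pos`, `N ≥ u ≥ 2`). [this file] -/
theorem series_of_profileAt {ω₂ lam β γ T c : ℝ} {L₀ : ℕ} (hω : 0 < ω₂) (hl : 0 < lam) (hβ : 0 < β) (hγ : 0 < γ) (hT : 0 < T)
    (hE : EmbeddedBlockLawAt ω₂ lam β γ T c L₀) (hB : BufferFloorAt ω₂ lam β γ T c L₀) :
    ∃ N₂ : ℕ, ∀ u v : ℕ, N₂ ≤ u → N₂ ≤ v →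
      1 / escapeDeficit ω₂ lam β γ T u + 1 / escapeDeficit ω₂ lam β γ T v
        ≤ 1 / escapeDeficit ω₂ lam β γ T (u + L₀ + v) := by
  obtain ⟨N₂, hE⟩ := hE
  obtain ⟨N₂', hB⟩ := hB
  refine ⟨max (max N₂ N₂') 2, fun u v hu hv => ?_⟩
  have hu2 : 2 ≤ u := le_trans (le_max_right _ _) hu
  have hv2 : 2 ≤ v := le_trans (le_max_right _ _) hv
  have huN : N₂ ≤ u := le_trans (le_trans (le_max_left _ _) (le_max_left _ _)) hu
  have hvN : N₂ ≤ v := le_trans (le_trans (le_max_left _ _) (le_max_left _ _)) hv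
  have huN' : N₂' ≤ u := le_trans (le_trans (le_max_right _ _) (le_max_left _ _)) hu
  have hvN' : N₂' ≤ v := le_trans (le_trans (le_max_right _ _) (le_max_left _ _)) hv
  set EN := escapeDeficit ω₂ lam β γ T (u + L₀ + v) with hEN_def
  set Eu := escapeDeficit ω₂ lam β γ T u with hEu_def
  set Ev := escapeDeficit ω₂ lam β γ T v with hEv_def
  have hENpos : 0 < EN := escapeDeficit_pos hω hl hβ hγ hT (by omega)
  -- the key inequality `E_N · (1/E_u + 1/E_v) ≤ 1`
  have key : EN * (1 / Eu + 1 / Ev) ≤ 1 := by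
    refine le_of_forall_pos_le_add fun ε hε => ?_
    have hε3 : 0 < ε / 3 := by positivity
    obtain ⟨δ₁, hδ₁, h1⟩ := hE u v huN hvN (by omega) (by omega) (ε / 3) hε3
    obtain ⟨δ₂, hδ₂, h2⟩ := hB u v huN' hvN' (by omega) (by omega) (ε / 3) hε3
    set δ : ℝ := min (min δ₁ δ₂) T / 2 with hδ_def
    have hm1 : min (min δ₁ δ₂) T ≤ δ₁ := (min_le_left _ _).trans (min_le_left _ _)
    have hm2 : min (min δ₁ δ₂) T ≤ δ₂ := (min_le_left _ _).trans (min_le_right _ _)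
    have hmT : min (min δ₁ δ₂) T ≤ T := min_le_right _ _
    have hmpos : 0 < min (min δ₁ δ₂) T := lt_min (lt_min hδ₁ hδ₂) hT
    have hδpos : 0 < δ := by rw [hδ_def]; linarith
    have hδlt1 : δ < δ₁ := by rw [hδ_def]; linarith
    have hδlt2 : δ < δ₂ := by rw [hδ_def]; linarith
    have hTL : 0 < T + δ / 2 := by linarith
    have hTR : 0 < T - δ / 2 := by rw [hδ_def]; linarith
    obtain ⟨μ, hμ⟩ := pinnedChain_exists_isSteadyState hω hl hβ hγ (u + L₀ + v) hTL hTR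
    obtain ⟨hleft, hright⟩ := h1 δ hδpos hδlt1 μ hμ
    have hmid := h2 δ hδpos hδlt2 μ hμ
    -- add the three drops: the interface temperatures cancel, the total is `δ`
    have hsum : δ * (EN * (1 / Eu + 1 / Ev) - ε) ≤ δ := by
      have hadd := add_le_add (add_le_add hleft hmid) hright
      have hlhs : δ * (EN * (1 / Eu - c) - ε / 3) + δ * (2 * c * EN - ε / 3) + δ * (EN * (1 / Ev - c) - ε / 3)
          = δ * (EN * (1 / Eu + 1 / Ev) - ε) := by ring
      have hrhs : (T + δ / 2 - ∫ x, x.2 ⟨u - 1, by omega⟩ ^ 2 ∂μ)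
          + (∫ x, x.2 ⟨u - 1, by omega⟩ ^ 2 ∂μ - ∫ x, x.2 ⟨u + L₀, by omega⟩ ^ 2 ∂μ)
          + (∫ x, x.2 ⟨u + L₀, by omega⟩ ^ 2 ∂μ - (T - δ / 2)) = δ := by ring
      linarith
    have hdiv : EN * (1 / Eu + 1 / Ev) - ε ≤ 1 := by
      by_contra hcon
      push Not at hcon
      have : δ * 1 < δ * (EN * (1 / Eu + 1 / Ev) - ε) := mul_lt_mul_of_pos_left hcon hδpos
      linarith
    linarith
  -- divide by `E_N > 0`
  rw [le_div_iff₀ hENpos]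
  calc (1 / Eu + 1 / Ev) * EN = EN * (1 / Eu + 1 / Ev) := by ring
    _ ≤ 1 := key

/-- **`ProfileSplitLaw ⟹ BufferedSeriesLaw`.** [this file] -/
theorem bufferedSeriesLaw_of_profileSplitLaw (h : ProfileSplitLaw) : BufferedSeriesLaw := by
  intro ω₂ lam β γ hω hl hβ hγ T hT
  obtain ⟨c, L₀, hE, hB⟩ := h ω₂ lam β γ hω hl hβ hγ T hT
  obtain ⟨N₂, hN⟩ := series_of_profileAt hω hl hβ hγ hT hE hB
  exact ⟨L₀, N₂, hN⟩

/-- **`ProfileSplitLaw ⟹ BoundedResponse`** (11071 BY NAME; via file 3's `boundedResponse_of_bufferedSeriesLaw`). [frame] -/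
theorem boundedResponse_of_profileSplitLaw : ProfileSplitLaw → BoundedResponse := fun h =>
  boundedResponse_of_bufferedSeriesLaw (bufferedSeriesLaw_of_profileSplitLaw h)

/-- Monotonicity in the buffer constant is NOT free (the two pieces pull `c` in opposite directions); what IS free: a larger `ε`-slack, and
weakening the locality piece's `c` while strengthening the floor's — recorded as the one-directional trade
`EmbeddedBlockLawAt … c L₀ → c ≤ c' → BufferFloorAt … c' L₀ → (series inequality)`. [this file] -/
theorem series_of_profileAt_trade {ω₂ lam β γ T c c' : ℝ} {L₀ : ℕ} (hω : 0 < ω₂) (hl : 0 < lam) (hβ : 0 < β) (hγ : 0 < γ)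
    (hT : 0 < T) (hcc' : c ≤ c') (hE : EmbeddedBlockLawAt ω₂ lam β γ T c L₀) (hB : BufferFloorAt ω₂ lam β γ T c' L₀) :
    ∃ N₂ : ℕ, ∀ u v : ℕ, N₂ ≤ u → N₂ ≤ v →
      1 / escapeDeficit ω₂ lam β γ T u + 1 / escapeDeficit ω₂ lam β γ T v
        ≤ 1 / escapeDeficit ω₂ lam β γ T (u + L₀ + v) := by
  -- strengthen the floor from `c'` down to `c` (its right-hand side only decreases, as `E_N ≥ 0` for `N ≥ 2`)
  refine series_of_profileAt hω hl hβ hγ hT hE ?_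
  obtain ⟨N₂, hB⟩ := hB
  refine ⟨max N₂ 2, fun u v hu hv hu1 hv1 ε hε => ?_⟩
  obtain ⟨δ₀, hδ₀, h⟩ := hB u v (le_trans (le_max_left _ _) hu) (le_trans (le_max_left _ _) hv) hu1 hv1 ε hε
  refine ⟨δ₀, hδ₀, fun δ hδ hδδ₀ μ hμ => ?_⟩
  have hineq := h δ hδ hδδ₀ μ hμ
  have hEN : 0 < escapeDeficit ω₂ lam β γ T (u + L₀ + v) :=
    escapeDeficit_pos hω hl hβ hγ hT (by have := le_trans (le_max_right N₂ 2) hu; omega)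
  have hmono : δ * (2 * c * escapeDeficit ω₂ lam β γ T (u + L₀ + v) - ε)
      ≤ δ * (2 * c' * escapeDeficit ω₂ lam β γ T (u + L₀ + v) - ε) := by
    apply mul_le_mul_of_nonneg_left _ hδ.le
    nlinarith
  exact hmono.trans hineq

end JunctionDefectGrading

end Summit.AtomisticToContinuum.FouriersLaw.Theorems.SubdiffusiveBondHeat

end
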